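import Summits.BirchSwinnertonDyer.BirchSwinnertonDyer.Theorems.ErratumRoadFiveNonSurjCornerOfItemsR16
import HarnessLib

/-!
# Route `ErratumRoadFive` (rung K2), crux `NonSurjCorner` (item stmt-BirchSwinnertonDyer-19065), registered line `Lines/hybrid.lean`:
# GLUE #18′ — glue #18 with slot 4 = the crux `X11aLowerHalf` (item 19064) BY NAME instead of the six Hida-side names, and the matching
# items-keyed closer (variant B of `…NonSurjCornerOfItemsR16`): the by-items shape of 19065 in which slot 4 needs NO new support item
# (cell `bsd-stepL`, seat `bsd-stepL-corner-p1` g17; `--supports stmt-BirchSwinnertonDyer-19065 --as helper`; offered to the planner — nothing filed here)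

WHY THIS FILE. Glue #18 (`…HybridPoitouTateKernel`) derives the leaf-twin lower half `h₄ℓ` from 19948 + six Hida-side named facts (RULING 48's narrowing:
19064 WHOLE is rung K6's object). For a «closes modulo route items» re-split of 19065 (the shape RULING 65 (c) gives 19715) the planner may prefer to key
slot 4 on the EXISTING crux item `X11aLowerHalf` (19064) rather than file a six-name Hida support item: 19064 implies the leaf-twin lower half a fortiori
(`lowerLeafTwinDeep_of_x11aLowerHalf`, g16). THIS FILE = glue #18 with the binder `hHida` replaced by `h₃ : X11aLowerHalf` (BY NAME) and the Hida derivation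
replaced by that one-liner; everything else VERBATIM:
* **glue #18′ `nonSurjCorner_of_kolyZShaAn_of_twinMuAn_of_fifteenFacts_of_x11aLowerHalf_of_twoPlusFiveNamedInputs_of_carrierLabelsB6_pAnchor`**;
* **`nonSurjCorner_of_items_r16_x11a`** — variant B of `nonSurjCorner_of_items_r16` (p634078): items BY NAME {19946, 19948, 19066 `PublishedInputsFive`, 19064
  `X11aLowerHalf`, `ShimuraParametrizationDataNonempty`, `PastenComponentOrdersInput`, `ShimuraCasselsTateLevelInputs`}; displayed (not yet item-stated): the
  fifteen-fact slot 3 (RULING 56's `KatoTwinFactsFiveAnContra` text), the two MAX-road names IMAGE-FREE, `shimuraCurve_heegnerSystem_primitivesFromFiveIrr`,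
  the corner (B6) text — FOUR support items away from a by-items glue.
Trade-off for the planner: variant A (p634078) keeps 19064 out of 19065's cone at the price of a six-name Hida support item; variant B needs no Hida item
but puts rung K6's crux back among 19065's children (as r5 had it).

HONEST FRAMING: TWO THEOREMS (no definition, no named fact, no `sorry`); CONDITIONAL on every binder; 19065 is NOT closed by this file; nothing is filed or
registered by this seat (D-0145 ∕ RULING 21); nothing about any curve's BSD; BSD is not advanced; T7.
References (locators only): [cite: PastenShimura2024, Prop. 6.13, Lemma 6.18] [cite: Jetchev2008, Thm. 1.1, Cor. 1.5] [cite: Cha2005, Thm. 21, Rmk. 25]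
[cite: Kato2004Asterisque, Thm. 12.4, §17.13] [cite: GrossLMS1991, §3 Prop. 3.7 (2)] [cite: MilneADT2006, Ch. I Thm. 4.10(b)] [cite: Miller2011LMS, Def. 1.1].
-/

set_option autoImplicit false
set_option linter.dupNamespace false -- `Summit.BirchSwinnertonDyer.BirchSwinnertonDyer` (summit = problem), tree-wide

noncomputable section

open scoped Classical NumberField MatrixGroups ModularForm

namespace Summit.BirchSwinnertonDyer.BirchSwinnertonDyer.Theorems

open CongruenceSubgroup WeierstrassCurve NumberField IsDedekindDomain Field Rat.HeightOneSpectrum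
  Literature.NumberTheory.EllipticCurves
  Literature.NumberTheory.EllipticCurves.ModularForms
  Literature.NumberTheory.Automorphic
  Literature.NumberTheory.EllipticCurves.Rank1Residual
  Literature.NumberTheory.EllipticCurves.Rank1Residual.Typed
  Literature.NumberTheory.EllipticCurves.Wuthrich2014
  Literature.NumberTheory.EllipticCurves.SteinWuthrich2013
  Literature.NumberTheory.EllipticCurves.Greenberg1999
  Literature.NumberTheory.EllipticCurves.Kato2004
  Literature.NumberTheory.EllipticCurves.BarriosEtAl2025
  Literature.NumberTheory.EllipticCurves.EmertonPollackWeston2006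
  Literature.NumberTheory.EllipticCurves.ShimuraCMFamily
  Literature.NumberTheory.GaloisRepresentations Literature.NumberTheory.GaloisCohomology
  Summit.BirchSwinnertonDyer.Rank1Residual
  Summit.BirchSwinnertonDyer.Rank1Residual.X11b
  Summit.BirchSwinnertonDyer.Rank1Residual.X11b.Three.Koly
  Summit.BirchSwinnertonDyer.BirchSwinnertonDyer.Theses.ErratumRoadFive

/-- **THE HYBRID GLUE (glue #18′) — SLOT 4 BY THE CRUX `X11aLowerHalf`.** As glue #18 (`…HybridPoitouTateKernel`) with the six Hida-side names replaced by
`h₃ : X11aLowerHalf` (item 19064, BY NAME): the leaf-twin lower half is `lowerLeafTwinDeep_of_x11aLowerHalf h₃`. Binders: `hZan` → 19948 → `hF3` → 19064 →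
hMax2 → hShim5 → `hLabB6T` → `NonSurjCorner`. CONDITIONAL on every binder; 19065 NOT closed; nothing booked; T7.
[cite: PastenShimura2024, Lemma 6.18] [cite: Jetchev2008, Thm. 1.1 and Cor. 1.5] [cite: Kato2004Asterisque, §17.13 (pp. 279–280)] [cite: Mazur1978, Cor. 4.1]
[cite: Miller2011LMS, Def. 1.1] [cite: Cha2005, Thm. 21 and Rmk. 25] -/
theorem nonSurjCorner_of_kolyZShaAn_of_twinMuAn_of_fifteenFacts_of_x11aLowerHalf_of_twoPlusFiveNamedInputs_of_carrierLabelsB6_pAnchor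
    (hZan : ∀ (W : WeierstrassCurve ℚ) [W.IsElliptic] [W.IsGloballyMinimal] (p : ℕ) [Fact p.Prime]
      (N : ℕ) [NeZero N] (K : Type) [Field K] [NumberField K]
      (Dt : ModularParametrizationData W N) (β : ℤ) (ι : K →+* ℂ),
      ClassX11b W p → ¬ Surj W p → (p = 5 ∨ p = 7) → p ∣ padicValInt p W.minimalDiscriminantInt →
      ¬ Ram W p → (∃ s : ℚ, shaAn W = (s : ℂ) ∧ 0 < padicValRat p s) →
      W.conductorNorm ℤ = N → IsImaginaryQuadratic K →
      4 < (NumberField.discr K).natAbs → SatisfiesHeegnerHypothesis N K →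
      SatisfiesHeegnerHypothesis p K → (4 * (N : ℤ)) ∣ β ^ 2 - NumberField.discr K → ¬ (p : ℤ) ∣ Dt.c →
      (∃ (d₁ : KolyvaginHeegnerData Dt β ι 1) (y : (W.baseChange K).toAffine.Point),
        WeierstrassCurve.Affine.Point.map (W' := W) (algebraMap K (ringClassField K ι 1)).toRatAlgHom y =
          d₁.derivedPoint ∧
        ∃ Q : (W.baseChange K).toAffine.Point, ((p ^ (padicValNat p W.tamagawaProduct + 1) : ℕ) : ℤ) • Q = y) →
      ∃ M : ℕ, M ≤ padicValNat p W.tamagawaProduct ∧ CertificateAt Dt β ι p M)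
    (hμ : NonSurjCornerTwinMuAn)
    -- slot 3 (r14): FIFTEEN named facts — r11–r13's sixteen minus conjunct 16 (Cha 2005 Rmk. 25 upper, discharged inside on the corner)
    (hF3 :
      (∀ (N : ℕ) [NeZero N] (W : WeierstrassCurve ℚ) (K : Type) [Field K] [NumberField K], Literature.NumberTheory.EllipticCurves.gross_zagier N W K) ∧
      (∀ (N : ℕ) [NeZero N] (W : WeierstrassCurve ℚ) (K : Type) [Field K] [NumberField K], Literature.NumberTheory.EllipticCurves.kolyvagin N W K) ∧
      Literature.NumberTheory.EllipticCurves.Wuthrich2014.sha_dvd_analyticSha ∧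
      Literature.NumberTheory.EllipticCurves.rank_eq_analyticRank_of_analyticRank_le_one ∧
      Literature.NumberTheory.EllipticCurves.ModularForms.exists_isNewformOf ∧
      Literature.NumberTheory.EllipticCurves.friedbergHoffstein_exists_heegnerField_split_twist_ne_zero ∧
      Literature.NumberTheory.EllipticCurves.ModularForms.mazur_not_dvd_maninConstant_of_odd ∧
      Literature.NumberTheory.EllipticCurves.SteinWuthrich2013.thm61_splitMultiplicative ∧
      Literature.NumberTheory.EllipticCurves.SteinWuthrich2013.thm61_nonsplitMultiplicative ∧
      (∀ (W : WeierstrassCurve ℚ) [W.IsElliptic] [W.IsGloballyMinimal] (p : ℕ) [Fact p.Prime], Literature.NumberTheory.EllipticCurves.greenberg_stevens (W := W) (p := p)) ∧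
      Literature.NumberTheory.EllipticCurves.Cha2005.rmk25_pow_dvd_card_sha_primary_of_certificate ∧
      Literature.NumberTheory.EllipticCurves.Kato2004.thm12_4 ∧
      Literature.NumberTheory.EllipticCurves.Kato2004.exists_multDivisibilityInputs_nonsplit_contra ∧
      Literature.NumberTheory.EllipticCurves.Kato2004.exists_multDivisibilityInputs_split_contra ∧
      Literature.NumberTheory.EllipticCurves.Kato2004.exists_multDivisibilityInputs_fine_contra)
    -- slot 4 (by-items variant B): the crux `X11aLowerHalf` (item 19064) BY NAME
    (h₃ : Summit.BirchSwinnertonDyer.BirchSwinnertonDyer.Theses.ErratumRoadFive.X11aLowerHalf)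
    -- slot 5, conjunct 1 (r16): TWO names — Poitou–Tate for Selmer structures is a tree theorem (selmerComplement_canonical_holds)
    (hMax2 : GrossLMS1991.prop37_2_frobeniusCongruence ∧ Gross1991_heegnerPoint_sub_ratTorsion_mem_E0_imageFree)
    -- slot 5, conjunct 2 (r12): FIVE named inputs of the Shimura roads — `shimuraCurve_heegnerSystem_primitivesSplitReduced` (the split-`p` road's
    -- CM primitives) is IDLE once `2` may pair: the datum₂ lemma always places `p` in the inert set (`p ∤ p − 1`), so the split road is never taken
    (hShim5 : friedbergHoffstein_exists_twist_ne_zero_inertAt ∧ nonempty_shimuraParametrizationData ∧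
      PastenShimura2024_componentOrders ∧
      (∀ (K : Type) [Field K] [NumberField K], casselsTate_levelInputs K) ∧
      shimuraCurve_heegnerSystem_primitivesFromFiveIrr)
    -- slot 6 (r10): the labelled CM family at the corner's inert frames with `d_K < −4`, WITH (B6) ONLY AT THE CARRIER PRIMES outside `S`
    (hLabB6T : ∀ (W : WeierstrassCurve ℚ) [W.IsElliptic] [W.IsGloballyMinimal] (p : ℕ) [Fact p.Prime],
      ClassX11b W p → ¬ Surj W p → (p = 5 ∨ p = 7) →
      ∀ (N : ℕ) [NeZero N] (K : Type) [Field K] [NumberField K] (S : Finset ℕ) (Dt : ModularParametrizationData W N)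
        (X : ShimuraCurveData (∏ q ∈ S, q) (N / ∏ q ∈ S, q)) (W' : WeierstrassCurve ℚ) [W'.IsElliptic]
        (P₀ : ShimuraParametrizationData X W'),
        W.conductorNorm ℤ = N → IsImaginaryQuadratic K → NumberField.discr K < -4 → Even S.card →
        (∀ ℓ ∈ S, ℓ.Prime ∧ ℓ ∣ N ∧ ¬ ℓ ^ 2 ∣ N ∧
          ((Ideal.span {(ℓ : ℤ)}).primesOver (𝓞 K)).ncard = 1 ∧ ¬ (ℓ : ℤ) ∣ NumberField.discr K) →
        (∀ ℓ : ℕ, ℓ.Prime → ℓ ∣ N → ℓ ∉ S → ((Ideal.span {(ℓ : ℤ)}).primesOver (𝓞 K)).ncard = 2) →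
        p ∈ S → ¬ (p : ℤ) ∣ Dt.c → P₀.IsMinimalFor W →
        ∃ (ι : K →+* ℂ) (y : (W.baseChange K).toAffine.Point) (degy : ℕ)
          (ys : (m : ℕ) → (W.baseChange (ringClassField K ι m)).toAffine.Point) (ε : ℤ), 0 < degy ∧
          padicValNat p degy = padicValNat p P₀.deg ∧
          LDerivEK W K = 8 * (Real.pi : ℂ) ^ 2 * peterssonProduct (CongruenceSubgroup.Gamma0 N) 2 Dt.f Dt.f /
              ((((Units.torsionOrder K : ℝ) / 2) ^ 2 * √|(NumberField.discr K : ℝ)| : ℝ) : ℂ) *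
            ((y.canonicalHeight : ℂ) / (degy : ℂ)) ∧
          (¬ IsOfFinAddOrder y → 0 < (AddSubgroup.zmultiples y).index) ∧
          ShimuraWalk.LabelsAt W N K ι y ys ε ∧
          ∀ (q : ℕ) [Fact q.Prime], q ∣ N → q ∉ S → p ∣ (W.baseChange ℚ_[q]).localTamagawaNumber ℤ_[q] → LabelB6 ι W N {q} ys) :
    Summit.BirchSwinnertonDyer.BirchSwinnertonDyer.Theses.ErratumRoadFive.NonSurjCorner := by
  obtain ⟨hGZ, hKo, hWu, hGZK, hnf, hFHs, hMaz, hJs, hJn, hGS, hChaL, h12, hns', hsp', hfine'⟩ := hF3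
  obtain ⟨h37, hF1⟩ := hMax2
  -- Poitou–Tate duality for the tree's Selmer structures: a THEOREM (Milne I 4.10(b) for the canonical maps, cell bsd-schneider p626891)
  have hPTs : ∀ (K : Type) [Field K] [NumberField K], poitouTate_selmerStructure_duality_conj K :=
    poitouTate_conj_forall_of_selmerComplement_canonical
      (fun K _ _ n _ ↦ SchneiderFreeAdditiveX3.PoitouTateReduction.selmerComplement_canonical_holds K n)
  obtain ⟨hFH, hJL, hCO, hCT, hLab⟩ := hShim5
  -- the seven former slot-3 conjuncts that are THEOREMS of the tree
  have hmod : hasEntireLFunction_rat := hasEntireLFunction_rat_of_exists_isNewformOf hnf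
  have hpar : nonempty_modularParametrizationData :=
    nonempty_modularParametrizationData_of_exists_isNewformOf hnf IsNewformOf.exists_maninConstant_ne_zero_holds
  have hrec : ∀ (N : ℕ) [NeZero N] (W : WeierstrassCurve ℚ) (K : Type) [Field K] [NumberField K],
      heegnerPointOfConductor_one_galoisConj N W K :=
    fun N _ W K _ _ ↦ heegnerPointOfConductor_one_galoisConj_holds N W K
  have hD36 : ∀ (N : ℕ) [NeZero N] (W : WeierstrassCurve ℚ) (K : Type) [Field K] [NumberField K],
      phi_heegnerTau_mem_singularModuliField N W K :=
    fun N _ W K _ _ ↦ phi_heegnerTau_mem_singularModuliField_holds N W K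
  have hPT : ∀ (K : Type) [Field K] [NumberField K],
      Literature.NumberTheory.GaloisCohomology.poitouTate_sum_localTatePairing_eq_zero K :=
    poitouTate_sum_localTatePairing_eq_zero_holds
  have hBR : localTamagawaNumber_quadraticTwist_two_mem_of_goodReduction :=
    BarriosEtAl2025.localTamagawaNumber_quadraticTwist_two_mem_of_goodReduction_holds
  -- slot 4: the leaf-twin lower half from the crux `X11aLowerHalf` BY NAME (a fortiori)
  have h₄ℓ : ∀ (Wd : WeierstrassCurve ℚ) [Wd.IsElliptic] [Wd.IsGloballyMinimal] (p : ℕ) [Fact p.Prime],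
      ClassX11a Wd p → ¬ Surj Wd p → (p = 5 ∨ p = 7) → p ∣ padicValInt p Wd.minimalDiscriminantInt →
      ¬ X11a.ShaAnUnit Wd p → Typed.MissingLowerBoundAt Wd p :=
    lowerLeafTwinDeep_of_x11aLowerHalf h₃
  -- slot 6 (r10): the SAVED display in D-form at every corner pair and every `q₁`, from the labels with (B6) at the CARRIERS, Poitou–Tate and CT
  have hSavD : ∀ (W : WeierstrassCurve ℚ) [W.IsElliptic] [W.IsGloballyMinimal] (p : ℕ) [Fact p.Prime],
      ClassX11b W p → ¬ Surj W p → (p = 5 ∨ p = 7) → ∀ (q₁ : ℕ) [Fact q₁.Prime], ShimuraInertSavedDisplayAtD W p q₁ :=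
    NonSurjCorner.shimuraInertSavedDisplayAtD_of_carrierLabelsB6 hPTs hCT hLabB6T
  exact X11b.erratumRoadFive_nonSurjCorner_of_kolyZShaAn_of_kolyJMax_of_multiUpper_of_lowerLeafTwinDeep_of_twinMultDivisibility_of_casselsTate
    hGZ hKo hWu hGZK hmod hnf hpar hFHs hMaz hrec hD36 hJs hJn hGS hChaL hCT h37 h₄ℓ hZan
    (X11b.Three.Koly.nonSurjCornerKolyJ_max_of_threeNamedFacts h37 hPTs hF1)
    (fun W _ _ p _ hX hns' h57 hv hnr htam hmulti ↦
      -- EVERY multi-carrier pair: parity datum + datum-free roads (p-anchor); the TWIN-LOWER SUPPLY from FH + the leaf-twin lower half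
      NonSurjCorner.missingUpperBoundAt_of_savedDisplayD_of_twinLower_pAnchor hGZK hmod hnf hMaz hBR hJL hCO hPT hCT hLab W p hX hns'
        h57 htam hmulti (NonSurjCorner.fhTwinLowerSupplyAt_of_lowerLeafTwinDeep hGZK hmod hnf hFH h₄ℓ W p hX hns' h57 hv hnr)
        (fun q₁ _ ↦ hSavD W p hX hns' h57 q₁))
    (fun Wd _ _ p _ hXa hnsd h57 hvd ↦
      X11b.multDivisibilityAt_of_katoFacts_of_muAn_contra_of_mazur Kato2004.nonempty_iwasawaH1Data_holds h12 hnf hns' hsp' hfine'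
        hMaz Wd p hXa.2.1 hXa.2.2.1 hXa.2.2.2.1 hnsd (fun f hf ϖ hϖ a L hsa hna hL ↦ hμ Wd p hXa hnsd h57 hvd f hf ϖ hϖ a L hsa hna hL))

/-- **Variant B of the items-keyed closer: slot 4 = `X11aLowerHalf` (19064) BY NAME.** Items BY NAME: `NonSurjCornerKolyZ` (19946, restricted inside),
`NonSurjCornerTwinMuAn` (19948), `PublishedInputsFive` (19066), `X11aLowerHalf` (19064), `ShimuraParametrizationDataNonempty`, `PastenComponentOrdersInput`,
`ShimuraCasselsTateLevelInputs`; displayed (not yet item-stated): `hF3` (fifteen), `hMax2` (two, image-free), `hLab`, `hLabB6T`. Then glue #18′.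
CONDITIONAL; 19065 NOT closed; T7. -/
theorem nonSurjCorner_of_items_r16_x11a
    (hZ : NonSurjCornerKolyZ) (hμ : NonSurjCornerTwinMuAn) (h₅ : PublishedInputsFive)
    (hF3 :
      (∀ (N : ℕ) [NeZero N] (W : WeierstrassCurve ℚ) (K : Type) [Field K] [NumberField K], Literature.NumberTheory.EllipticCurves.gross_zagier N W K) ∧
      (∀ (N : ℕ) [NeZero N] (W : WeierstrassCurve ℚ) (K : Type) [Field K] [NumberField K], Literature.NumberTheory.EllipticCurves.kolyvagin N W K) ∧
      Literature.NumberTheory.EllipticCurves.Wuthrich2014.sha_dvd_analyticSha ∧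
      Literature.NumberTheory.EllipticCurves.rank_eq_analyticRank_of_analyticRank_le_one ∧
      Literature.NumberTheory.EllipticCurves.ModularForms.exists_isNewformOf ∧
      Literature.NumberTheory.EllipticCurves.friedbergHoffstein_exists_heegnerField_split_twist_ne_zero ∧
      Literature.NumberTheory.EllipticCurves.ModularForms.mazur_not_dvd_maninConstant_of_odd ∧
      Literature.NumberTheory.EllipticCurves.SteinWuthrich2013.thm61_splitMultiplicative ∧
      Literature.NumberTheory.EllipticCurves.SteinWuthrich2013.thm61_nonsplitMultiplicative ∧
      (∀ (W : WeierstrassCurve ℚ) [W.IsElliptic] [W.IsGloballyMinimal] (p : ℕ) [Fact p.Prime], Literature.NumberTheory.EllipticCurves.greenberg_stevens (W := W) (p := p)) ∧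
      Literature.NumberTheory.EllipticCurves.Cha2005.rmk25_pow_dvd_card_sha_primary_of_certificate ∧
      Literature.NumberTheory.EllipticCurves.Kato2004.thm12_4 ∧
      Literature.NumberTheory.EllipticCurves.Kato2004.exists_multDivisibilityInputs_nonsplit_contra ∧
      Literature.NumberTheory.EllipticCurves.Kato2004.exists_multDivisibilityInputs_split_contra ∧
      Literature.NumberTheory.EllipticCurves.Kato2004.exists_multDivisibilityInputs_fine_contra)
    (h₃ : X11aLowerHalf)
    (hMax2 : GrossLMS1991.prop37_2_frobeniusCongruence ∧ Gross1991_heegnerPoint_sub_ratTorsion_mem_E0_imageFree)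
    (hJL : ShimuraParametrizationDataNonempty) (hCO : PastenComponentOrdersInput) (hCTi : ShimuraCasselsTateLevelInputs)
    (hLab : shimuraCurve_heegnerSystem_primitivesFromFiveIrr)
    (hLabB6T : ∀ (W : WeierstrassCurve ℚ) [W.IsElliptic] [W.IsGloballyMinimal] (p : ℕ) [Fact p.Prime],
      ClassX11b W p → ¬ Surj W p → (p = 5 ∨ p = 7) →
      ∀ (N : ℕ) [NeZero N] (K : Type) [Field K] [NumberField K] (S : Finset ℕ) (Dt : ModularParametrizationData W N)
        (X : ShimuraCurveData (∏ q ∈ S, q) (N / ∏ q ∈ S, q)) (W' : WeierstrassCurve ℚ) [W'.IsElliptic]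
        (P₀ : ShimuraParametrizationData X W'),
        W.conductorNorm ℤ = N → IsImaginaryQuadratic K → NumberField.discr K < -4 → Even S.card →
        (∀ ℓ ∈ S, ℓ.Prime ∧ ℓ ∣ N ∧ ¬ ℓ ^ 2 ∣ N ∧
          ((Ideal.span {(ℓ : ℤ)}).primesOver (𝓞 K)).ncard = 1 ∧ ¬ (ℓ : ℤ) ∣ NumberField.discr K) →
        (∀ ℓ : ℕ, ℓ.Prime → ℓ ∣ N → ℓ ∉ S → ((Ideal.span {(ℓ : ℤ)}).primesOver (𝓞 K)).ncard = 2) →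
        p ∈ S → ¬ (p : ℤ) ∣ Dt.c → P₀.IsMinimalFor W →
        ∃ (ι : K →+* ℂ) (y : (W.baseChange K).toAffine.Point) (degy : ℕ)
          (ys : (m : ℕ) → (W.baseChange (ringClassField K ι m)).toAffine.Point) (ε : ℤ), 0 < degy ∧
          padicValNat p degy = padicValNat p P₀.deg ∧
          LDerivEK W K = 8 * (Real.pi : ℂ) ^ 2 * peterssonProduct (CongruenceSubgroup.Gamma0 N) 2 Dt.f Dt.f /
              ((((Units.torsionOrder K : ℝ) / 2) ^ 2 * √|(NumberField.discr K : ℝ)| : ℝ) : ℂ) *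
            ((y.canonicalHeight : ℂ) / (degy : ℂ)) ∧
          (¬ IsOfFinAddOrder y → 0 < (AddSubgroup.zmultiples y).index) ∧
          ShimuraWalk.LabelsAt W N K ι y ys ε ∧
          ∀ (q : ℕ) [Fact q.Prime], q ∣ N → q ∉ S → p ∣ (W.baseChange ℚ_[q]).localTamagawaNumber ℤ_[q] → LabelB6 ι W N {q} ys)
    : NonSurjCorner :=
  nonSurjCorner_of_kolyZShaAn_of_twinMuAn_of_fifteenFacts_of_x11aLowerHalf_of_twoPlusFiveNamedInputs_of_carrierLabelsB6_pAnchor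
    (fun W _ _ p _ N _ K _ _ Dt β ι hX hns h57 hv hnr _ hN hK hdisc hHN hHp hβ hc _ ↦
      hZ W p N K Dt β ι hX hns h57 hv hnr hN hK hdisc hHN hHp hβ hc)
    hμ hF3 h₃ hMax2 ⟨h₅.2.2.2.2.2.2.2.2.2.2.2.2.1, hJL, hCO, hCTi, hLab⟩ hLabB6T

end Summit.BirchSwinnertonDyer.BirchSwinnertonDyer.Theorems

end
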